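import Literature.Topology.FourManifolds.TautFoliationsNovikov
import Literature.Topology.FourManifolds.TautFoliationsDeadEnds
import HarnessLib

/-!
# Novikov's theorem on taut foliations, reduced to its core: Reeb components from non-injective leaves

Sibling of `TautFoliationsNovikov.lean` (the named fact
`Literature.Topology.FourManifolds.Foliation.fundamentalGroup_map_injective_of_isTaut`: compact leaves of transversely oriented
taut `C⁰` foliations of closed oriented 3-manifolds are `π₁`-injective — Novikov (1965); Gabai
(1983), Thm. 2.8 (4); for `C⁰` foliations Solodov (1984), Bowden (2016), Thm. 2.7) and of
`TautFoliationsDeadEnds.lean` (**proved**: in a taut transversely oriented `C⁰` foliation no leaf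
is the frontier of a closed region which is the closure of its interior,
`Foliation.frontier_ne_leaf_of_isTaut`).

The printed proof of Novikov's theorem has two parts of very different size:

1. (*the core*; Novikov (1965), via vanishing cycles; `C⁰`: Solodov (1984); Bowden (2016),
   Thm. 2.7) a transversely oriented codimension-one foliation of a
   closed 3-manifold with a leaf that is not `π₁`-injective has a **Reeb component**: a solid
   torus `R ⊆ M` whose boundary torus is a leaf (and whose interior is foliated by planes). Such
   an `R` is a closed region with `closure (interior R) = R` whose frontier is a single leaf.
2. (*the use of tautness*; Schultens (2014), Lemma 7.5.14; Goodman (1975)) a closed transversal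
   cannot meet the boundary leaf of such a region, so a taut foliation has none.

Part 2 is proved in `TautFoliationsDeadEnds.lean`. This file records the resulting **proved
reduction** `fundamentalGroup_map_injective_of_isTaut_of_core`: the named fact follows from
part 1, stated — in the weak form that is all part 2 needs — as the hypothesis "a compact leaf
which is not `π₁`-injective forces some leaf to be the frontier of a closed region that is the
closure of its interior". Part 1 is the theory-sized heart of Novikov's theorem (general
position of discs with respect to the foliation, Poincaré–Bendixson on the induced singular
foliation, vanishing cycles, the Reeb component they sweep out) and is **not** vendored here as a
named fact (D-0026: no new undischarged facts from a discharge attempt); it enters only as an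
explicit hypothesis of the reduction theorem, whose statement is otherwise literally the named
fact.

## References

* S. P. Novikov, *The topology of foliations*, Trudy Moskov. Mat. Obšč. 14 (1965) 248–278
  [Novikov1965].
* D. Gabai, *Foliations and the topology of 3-manifolds*, J. Differential Geom. 18 (1983),
  Thm. 2.8 (4), Def. 2.11 [Gabai1983].
* J. Schultens, *Introduction to 3-Manifolds* (2014), Thm. 7.5.12, Lemma 7.5.14 [Schultens2014].
* J. Bowden, *Approximating `C⁰`-foliations by contact structures*, GAFA 26 (2016), Thm. 2.7
  [Bowden2016].
* V. V. Solodov, *Components of topological foliations*, Math. USSR-Sb. 47 (1984) 329–343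
  [Solodov1984].
-/

open scoped Manifold ContDiff Topology
open Function Set

noncomputable section

universe u

namespace Literature.Topology.FourManifolds

/-- Local notation: `𝔼 n` is the model Euclidean space `EuclideanSpace ℝ (Fin n)`. -/
local notation "𝔼 " n:arg => EuclideanSpace ℝ (Fin n)

namespace Foliation

/-- **Novikov's theorem for taut foliations, from its core.** Hypothesis `hcore` is part 1 of
the printed proof (Novikov (1965); `C⁰`: Solodov (1984), Bowden (2016), Thm. 2.7), in weak
form: for every closed connected oriented 3-manifold `M`, every transversely
oriented `C⁰` codimension-one foliation `F` of `M` and every compact leaf `F.leaf x` whose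
inclusion is not `π₁`-injective at some base point, some leaf of `F` is the frontier of a
closed region `R ⊆ M` with `closure (interior R) = R` (as is the boundary torus of the Reeb
component that Novikov's vanishing cycle produces). Conclusion: the named fact
`fundamentalGroup_map_injective_of_isTaut` — because a taut transversely oriented foliation
admits no such leaf (`frontier_ne_leaf_of_isTaut`, proved: a positive closed transversal
through that leaf would have to enter the region at each crossing and could never leave).
This is a proved reduction, not a discharge: `hcore` is the theory-sized part of Novikov's
theorem. [cite: Gabai1983, Thm. 2.8 (4); Schultens2014, Lemma 7.5.14] -/
theorem fundamentalGroup_map_injective_of_isTaut_of_core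
    (hcore : ∀ {EM HM : Type} [NormedAddCommGroup EM] [NormedSpace ℝ EM]
      [FiniteDimensional ℝ EM] [TopologicalSpace HM] (IM : ModelWithCorners ℝ EM HM)
      [IM.Boundaryless] (_hdim : Module.finrank ℝ EM = 3)
      (M : Type u) [TopologicalSpace M] [T2Space M] [SecondCountableTopology M] [CompactSpace M]
      [ConnectedSpace M] [ChartedSpace HM M] [IsManifold IM ∞ M] (_hM : IsOrientable IM M)
      (F : Foliation (𝔼 2) M) (_ho : F.IsTransverselyOriented)
      (x : M) (_hx : IsCompact (F.leaf x)) (p : F.leaf x),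
      ¬ Injective (FundamentalGroup.map
          (⟨Subtype.val, continuous_subtype_val⟩ : C(F.leaf x, M)) p) →
        ∃ (R : Set M) (x' : M), closure (interior R) = R ∧ frontier R = F.leaf x') :
    fundamentalGroup_map_injective_of_isTaut.{u} := by
  intro EM HM _ _ _ _ IM _ hdim M _ _ _ _ _ _ _ hM F ho ht x hx p
  by_contra hinj
  obtain ⟨R, x', hreg, hT⟩ := hcore IM hdim M hM F ho x hx p hinj
  exact frontier_ne_leaf_of_isTaut ho ht hreg x' hT

end Foliation

end Literature.Topology.FourManifolds
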